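import Mathlib.Analysis.SpecialFunctions.Log.Deriv
import Mathlib.Analysis.SpecialFunctions.Log.Basic
import Mathlib.Data.Nat.Log
import Mathlib.Data.Nat.Size
import Mathlib.Tactic
import HarnessLib

/-!
# Fixed-point logarithms: rational approximations of `log n`, `log q` and `log |(P + √D)/Q|`
# to a prescribed dyadic precision

Topic `Computability/Cryptography`; numerics for the distance bookkeeping of Hallgren's algorithm
(`HallgrenPell.lean`, facts `Hallgren2007_regulator_qsolvable[_delim]`): Jozsa 2003, §9 Thm. 5
requires the Shanks distances `ln γ`, `γ = (b + √D)/2a`, "to a sufficient accuracy" by "a parallel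
computation of their accumulating distances", i.e. `n`-digit approximations of logarithms of
quadratic irrationalities in time poly`(log D, n)` (Jacobson–Williams, *Solving the Pell Equation*,
§11.1–11.2 use `(f, p)` representations for the same purpose). Theorem-and-definition file (no named
facts); the definitions are EXACT RATIONAL functions of integer data (partial sums of the series of
`−log(1 − x)`, binary exponent extraction, integer square roots), so that their polynomial-time
computability is a matter of the typed `FP` algebra `CodeFP` (separate file), while this file proves
the precision guarantees:

* `logSeries x n = ∑_{i<n} x^{i+1}/(i+1)` with `|logSeries x n + log(1 − x)| ≤ 2⁻ⁿ` for `|x| ≤ 1/2`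
  (Mathlib's `Real.abs_log_sub_add_sum_range_le`); `log2Approx n` (`x = 1/2`);
* `logNatApprox n a` (`n = 2ᵉ·y`, `y ∈ [1, 2)`): `|logNatApprox n a − log n| ≤ 2⁻ᵃ` for `n ≥ 1`;
* `logRatApprox q a`: `|logRatApprox q a − log q| ≤ 2⁻ᵃ` for `q > 0`;
* `sqrtShiftApprox D P b = (P·2ᵇ + ⌊√(D·4ᵇ)⌋)/2ᵇ`, within `2⁻ᵇ` of `P + √D`;
* **`logQIApprox D P Q a`**: `|logQIApprox D P Q a − log |(P + √D)/Q|| ≤ 2⁻ᵃ` for `D` not a square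
  and `Q ≠ 0` (the relative-precision step uses `|P + √D| ≥ 1/(|P| + D)`);
* `dyRound a q = ⌊q·2ᵃ⌋/2ᵃ` (rounding to the dyadic grid, `|dyRound a q − q| ≤ 2⁻ᵃ`), which keeps all
  accumulated approximations on one grid.

## References

* R. Jozsa, arXiv:quant-ph/0302134 (2003), §9 (proof of Thm. 5). [Jozsa2003]
* M. J. Jacobson, Jr., H. C. Williams, *Solving the Pell Equation*, Springer (2009), §11.1–§11.2.
  [JacobsonWilliams2008]
* R. P. Brent, P. Zimmermann, *Modern Computer Arithmetic*, CUP (2010), §4.4 (logarithm by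
  argument reduction and power series). [BrentZimmermann2010]
-/

noncomputable section

open Finset

namespace Literature.Computability.Cryptography

namespace FixedPointLog

/-! ### The series of `−log(1 − x)` -/

/-- `logSeries x n = ∑_{i<n} x^{i+1}/(i+1)`, the `n`-th partial sum of `−log(1 − x)`. [cite: BrentZimmermann2010, §4.4] -/
def logSeries (x : ℚ) (n : ℕ) : ℚ := ∑ i ∈ range n, x ^ (i + 1) / (i + 1)

/-- Cast of the partial sum. [folklore] -/
theorem cast_logSeries (x : ℚ) (n : ℕ) :
    ((logSeries x n : ℚ) : ℝ) = ∑ i ∈ range n, (x : ℝ) ^ (i + 1) / (i + 1) := by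
  unfold logSeries; push_cast; rfl

/-- **Truncation error**: `|logSeries x n + log(1 − x)| ≤ 2⁻ⁿ` for `|x| ≤ 1/2`. [cite: BrentZimmermann2010, §4.4] -/
theorem abs_logSeries_add_log_le {x : ℚ} (hx : |(x : ℝ)| ≤ 1 / 2) (n : ℕ) :
    |(logSeries x n : ℝ) + Real.log (1 - x)| ≤ (1 / 2) ^ n := by
  rw [cast_logSeries]
  refine (Real.abs_log_sub_add_sum_range_le (lt_of_le_of_lt hx (by norm_num)) n).trans ?_
  have h1 : |(x : ℝ)| ^ (n + 1) ≤ (1 / 2) ^ (n + 1) := pow_le_pow_left₀ (abs_nonneg _) hx _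
  have h2 : (1 : ℝ) / 2 ≤ 1 - |(x : ℝ)| := by linarith
  calc |(x : ℝ)| ^ (n + 1) / (1 - |(x : ℝ)|) ≤ (1 / 2) ^ (n + 1) / (1 / 2) :=
        div_le_div₀ (by positivity) h1 (by norm_num) h2
    _ = (1 / 2) ^ n := by rw [pow_succ]; field_simp

/-- `log 2 ≈ logSeries (1/2) n` (`log 2 = −log(1 − 1/2)`). [cite: BrentZimmermann2010, §4.4] -/
def log2Approx (n : ℕ) : ℚ := logSeries (1 / 2) n

/-- `|log2Approx n − log 2| ≤ 2⁻ⁿ`. [cite: BrentZimmermann2010, §4.4] -/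
theorem abs_log2Approx_sub_log_two_le (n : ℕ) : |(log2Approx n : ℝ) - Real.log 2| ≤ (1 / 2) ^ n := by
  have h := abs_logSeries_add_log_le (x := 1 / 2) (by push_cast; rw [abs_of_pos (by norm_num)]) n
  have e : Real.log (1 - ((1 / 2 : ℚ) : ℝ)) = -Real.log 2 := by
    push_cast
    rw [show (1 : ℝ) - 1 / 2 = (2 : ℝ)⁻¹ by norm_num, Real.log_inv]
  rw [e, ← sub_eq_add_neg] at h
  exact h

/-! ### Logarithms of positive integers and rationals -/

/-- `logNatApprox n a ≈ log n`: with `e = ⌊log₂ n⌋` and `x = (n − 2ᵉ)/n ∈ [0, 1/2)`,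
`log n = e·log 2 − log(1 − x)`. [cite: BrentZimmermann2010, §4.4 (argument reduction by powers of 2)] -/
def logNatApprox (n a : ℕ) : ℚ :=
  (Nat.log 2 n : ℚ) * log2Approx (a + 1 + Nat.log 2 n) +
    logSeries (((n : ℚ) - 2 ^ Nat.log 2 n) / n) (a + 1)

/-- `e · 2⁻ᵉ ≤ 1`. [folklore] -/
theorem natCast_mul_half_pow_le_one (e : ℕ) : (e : ℝ) * (1 / 2) ^ e ≤ 1 := by
  have h : (e : ℝ) ≤ 2 ^ e := by exact_mod_cast (Nat.lt_two_pow_self).le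
  have h2 : (0 : ℝ) < 2 ^ e := by positivity
  rw [one_div_pow, ← div_eq_mul_one_div, div_le_one h2]
  exact h

/-- **`|logNatApprox n a − log n| ≤ 2⁻ᵃ`** for `n ≥ 1`. [cite: BrentZimmermann2010, §4.4] -/
theorem abs_logNatApprox_sub_log_le {n : ℕ} (hn : 1 ≤ n) (a : ℕ) :
    |(logNatApprox n a : ℝ) - Real.log n| ≤ (1 / 2) ^ a := by
  set e := Nat.log 2 n with he
  have hpow : 2 ^ e ≤ n := Nat.pow_log_le_self 2 (by omega)
  have hlt : n < 2 ^ (e + 1) := Nat.lt_pow_succ_log_self one_lt_two n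
  have hnR : (0 : ℝ) < n := by exact_mod_cast hn
  have hpowR : (2 : ℝ) ^ e ≤ n := by exact_mod_cast hpow
  have hltR : (n : ℝ) < 2 ^ (e + 1) := by exact_mod_cast hlt
  set x : ℚ := ((n : ℚ) - 2 ^ e) / n with hx
  have hxR : (x : ℝ) = ((n : ℝ) - 2 ^ e) / n := by rw [hx]; push_cast; rfl
  have hx0 : (0 : ℝ) ≤ x := by rw [hxR]; exact div_nonneg (by linarith) hnR.le
  have hx2 : (x : ℝ) ≤ 1 / 2 := by
    rw [hxR, div_le_iff₀ hnR]
    rw [pow_succ] at hltR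
    linarith
  have habs : |(x : ℝ)| ≤ 1 / 2 := by rw [abs_of_nonneg hx0]; exact hx2
  -- `log(1 − x) = e log 2 − log n`
  have h1x : (1 : ℝ) - x = 2 ^ e / n := by rw [hxR]; field_simp; ring
  have hlog : Real.log (1 - x) = e * Real.log 2 - Real.log n := by
    rw [h1x, Real.log_div (by positivity) hnR.ne', Real.log_pow]
  have hA := abs_log2Approx_sub_log_two_le (a + 1 + e)
  have hB := abs_logSeries_add_log_le habs (a + 1)
  have hsplit : (logNatApprox n a : ℝ) - Real.log n =
      e * ((log2Approx (a + 1 + e) : ℝ) - Real.log 2) + ((logSeries x (a + 1) : ℝ) + Real.log (1 - x)) := by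
    rw [hlog]; unfold logNatApprox; push_cast; rw [← he, ← hx]; ring
  rw [hsplit]
  have he0 : (0 : ℝ) ≤ e := by positivity
  calc |(e : ℝ) * ((log2Approx (a + 1 + e) : ℝ) - Real.log 2) + ((logSeries x (a + 1) : ℝ) + Real.log (1 - x))|
      ≤ |(e : ℝ) * ((log2Approx (a + 1 + e) : ℝ) - Real.log 2)| + |(logSeries x (a + 1) : ℝ) + Real.log (1 - x)| :=
        abs_add_le _ _
    _ ≤ e * (1 / 2) ^ (a + 1 + e) + (1 / 2) ^ (a + 1) := by
        rw [abs_mul, abs_of_nonneg he0]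
        exact add_le_add (mul_le_mul_of_nonneg_left hA he0) hB
    _ = (1 / 2) ^ (a + 1) * ((e : ℝ) * (1 / 2) ^ e) + (1 / 2) ^ (a + 1) := by ring
    _ ≤ (1 / 2) ^ (a + 1) * 1 + (1 / 2) ^ (a + 1) := by
        gcongr
        exact natCast_mul_half_pow_le_one e
    _ = (1 / 2) ^ a := by rw [pow_succ]; ring

/-- `logRatApprox q a ≈ log q` (`log q = log num − log den`). [folklore] -/
def logRatApprox (q : ℚ) (a : ℕ) : ℚ := logNatApprox q.num.natAbs (a + 1) - logNatApprox q.den (a + 1)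

/-- **`|logRatApprox q a − log q| ≤ 2⁻ᵃ`** for `q > 0`. [folklore] -/
theorem abs_logRatApprox_sub_log_le {q : ℚ} (hq : 0 < q) (a : ℕ) :
    |(logRatApprox q a : ℝ) - Real.log q| ≤ (1 / 2) ^ a := by
  have hnum : 0 < q.num := Rat.num_pos.mpr hq
  have hden : 0 < q.den := q.den_pos
  have hnumN : 1 ≤ q.num.natAbs := by omega
  have hcast : (q : ℝ) = (q.num.natAbs : ℝ) / (q.den : ℝ) := by
    rw [Nat.cast_natAbs, Int.cast_abs, abs_of_pos (by exact_mod_cast hnum : (0 : ℝ) < q.num)]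
    exact Rat.cast_def q
  have hlog : Real.log q = Real.log (q.num.natAbs : ℝ) - Real.log (q.den : ℝ) := by
    rw [hcast, Real.log_div (by positivity) (by positivity)]
  have hA := abs_logNatApprox_sub_log_le hnumN (a + 1)
  have hB := abs_logNatApprox_sub_log_le hden (a + 1)
  rw [hlog]
  unfold logRatApprox
  push_cast
  calc |(logNatApprox q.num.natAbs (a + 1) : ℝ) - logNatApprox q.den (a + 1) -
        (Real.log (q.num.natAbs : ℝ) - Real.log (q.den : ℝ))|
      = |((logNatApprox q.num.natAbs (a + 1) : ℝ) - Real.log (q.num.natAbs : ℝ)) -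
          ((logNatApprox q.den (a + 1) : ℝ) - Real.log (q.den : ℝ))| := by ring_nf
    _ ≤ (1 / 2) ^ (a + 1) + (1 / 2) ^ (a + 1) := (abs_sub _ _).trans (add_le_add hA hB)
    _ = (1 / 2) ^ a := by rw [pow_succ]; ring

/-! ### Logarithms of quadratic irrationalities -/

/-- `|log x − log y| ≤ |x − y| / min x y` for `x, y > 0`. [folklore] -/
theorem abs_log_sub_log_le {x y : ℝ} (hx : 0 < x) (hy : 0 < y) :
    |Real.log x - Real.log y| ≤ |x - y| / min x y := by
  have hm : 0 < min x y := lt_min hx hy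
  rw [abs_le]
  constructor
  · -- `log y − log x ≤ (y − x)/x ≤ |x − y|/min`
    have h1 : Real.log y - Real.log x ≤ (y - x) / x := by
      have := Real.log_le_sub_one_of_pos (div_pos hy hx)
      rw [Real.log_div hy.ne' hx.ne'] at this
      rw [div_sub' (hc := hx.ne'), mul_one] at this  -- (y − x)/x
      exact this
    have h2 : (y - x) / x ≤ |x - y| / min x y := by
      rw [div_le_div_iff₀ hx hm]
      have : (y - x) * min x y ≤ |x - y| * min x y := by
        apply mul_le_mul_of_nonneg_right _ hm.le
        rw [abs_sub_comm]; exact le_abs_self _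
      exact this.trans (mul_le_mul_of_nonneg_left (min_le_left _ _) (abs_nonneg _))
    linarith
  · have h1 : Real.log x - Real.log y ≤ (x - y) / y := by
      have := Real.log_le_sub_one_of_pos (div_pos hx hy)
      rw [Real.log_div hx.ne' hy.ne'] at this
      rw [div_sub' (hc := hy.ne'), mul_one] at this
      exact this
    have h2 : (x - y) / y ≤ |x - y| / min x y := by
      rw [div_le_div_iff₀ hy hm]
      have : (x - y) * min x y ≤ |x - y| * min x y :=
        mul_le_mul_of_nonneg_right (le_abs_self _) hm.le
      exact this.trans (mul_le_mul_of_nonneg_left (min_le_right _ _) (abs_nonneg _))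
    linarith

/-- `sqrtShiftApprox D P b = (P·2ᵇ + ⌊√(D·4ᵇ)⌋)/2ᵇ`, a dyadic approximation of `P + √D`.
[cite: JacobsonWilliams2008, §11.1 (rational approximation of (P+√D)/Q)] -/
def sqrtShiftApprox (D : ℕ) (P : ℤ) (b : ℕ) : ℚ :=
  ((P * 2 ^ b + (Nat.sqrt (D * 4 ^ b) : ℕ) : ℤ) : ℚ) / 2 ^ b

/-- `⌊√(D·4ᵇ)⌋ / 2ᵇ` is within `2⁻ᵇ` below `√D`. [folklore] -/
theorem sqrt_sub_lt (D b : ℕ) :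
    0 ≤ Real.sqrt D - (Nat.sqrt (D * 4 ^ b) : ℝ) / 2 ^ b ∧
      Real.sqrt D - (Nat.sqrt (D * 4 ^ b) : ℝ) / 2 ^ b < 1 / 2 ^ b := by
  set s := Nat.sqrt (D * 4 ^ b) with hs
  have h1 : s ^ 2 ≤ D * 4 ^ b := Nat.sqrt_le' _
  have h2 : D * 4 ^ b < (s + 1) ^ 2 := Nat.lt_succ_sqrt' _
  have hpow : (0 : ℝ) < 2 ^ b := by positivity
  have h4 : ((4 : ℝ) ^ b) = ((2 : ℝ) ^ b) ^ 2 := by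
    rw [← pow_mul, mul_comm b 2, pow_mul]; norm_num
  have hsq : Real.sqrt ((D : ℝ) * 4 ^ b) = 2 ^ b * Real.sqrt D := by
    rw [h4, mul_comm, Real.sqrt_mul (by positivity), Real.sqrt_sq hpow.le]
  have hle : (s : ℝ) ≤ 2 ^ b * Real.sqrt D := by
    rw [← hsq, show (s : ℝ) = Real.sqrt ((s : ℝ) ^ 2) from (Real.sqrt_sq (by positivity)).symm]
    exact Real.sqrt_le_sqrt (by exact_mod_cast h1)
  have hlt : 2 ^ b * Real.sqrt D < s + 1 := by
    rw [← hsq, show (s : ℝ) + 1 = Real.sqrt (((s : ℝ) + 1) ^ 2) from (Real.sqrt_sq (by positivity)).symm]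
    exact Real.sqrt_lt_sqrt (by positivity) (by exact_mod_cast h2)
  constructor
  · rw [sub_nonneg, div_le_iff₀ hpow]; linarith
  · rw [sub_lt_iff_lt_add, ← add_div, lt_div_iff₀ hpow]; linarith

/-- `|sqrtShiftApprox D P b − (P + √D)| ≤ 2⁻ᵇ`. [folklore] -/
theorem abs_sqrtShiftApprox_sub_le (D : ℕ) (P : ℤ) (b : ℕ) :
    |(sqrtShiftApprox D P b : ℝ) - (P + Real.sqrt D)| ≤ 1 / 2 ^ b := by
  obtain ⟨h1, h2⟩ := sqrt_sub_lt D b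
  have e : (sqrtShiftApprox D P b : ℝ) = P + (Nat.sqrt (D * 4 ^ b) : ℝ) / 2 ^ b := by
    unfold sqrtShiftApprox; push_cast; field_simp
  rw [e, show (P : ℝ) + (Nat.sqrt (D * 4 ^ b) : ℝ) / 2 ^ b - (P + Real.sqrt D) =
    -(Real.sqrt D - (Nat.sqrt (D * 4 ^ b) : ℝ) / 2 ^ b) by ring, abs_neg, abs_of_nonneg h1]
  exact h2.le

/-- `P + √D ≠ 0` and indeed `|P + √D| ≥ 1/(|P| + D)` when `D ≥ 1` is not a square
(`|P + √D|·|P − √D| = |P² − D| ≥ 1`). [folklore] -/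
theorem inv_le_abs_add_sqrt {D : ℕ} (hD : ¬ IsSquare D) (hD1 : 1 ≤ D) (P : ℤ) :
    1 / (|(P : ℝ)| + D) ≤ |(P : ℝ) + Real.sqrt D| := by
  have hsD : Real.sqrt (D : ℝ) ^ 2 = D := Real.sq_sqrt (Nat.cast_nonneg D)
  have hD1R : (1 : ℝ) ≤ D := by exact_mod_cast hD1
  have hsqrt_le : Real.sqrt (D : ℝ) ≤ D := by
    rw [Real.sqrt_le_left (by positivity)]; nlinarith
  have hne : (P : ℤ) ^ 2 - D ≠ 0 := by
    intro h
    apply hD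
    refine ⟨P.natAbs, ?_⟩
    have : (D : ℤ) = P.natAbs * P.natAbs := by rw [← sq, Int.natAbs_sq]; linarith
    exact_mod_cast this
  have hge : (1 : ℝ) ≤ |((P : ℝ) ^ 2 - D)| := by
    have : (1 : ℤ) ≤ |P ^ 2 - (D : ℤ)| := Int.one_le_abs hne
    exact_mod_cast this
  have hprod : |((P : ℝ) + Real.sqrt D)| * |(P : ℝ) - Real.sqrt D| = |((P : ℝ) ^ 2 - D)| := by
    rw [← abs_mul]; congr 1; nlinarith [hsD]
  have hpos : (0 : ℝ) < |(P : ℝ)| + D := by positivity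
  have hbd : |(P : ℝ) - Real.sqrt D| ≤ |(P : ℝ)| + D := by
    calc |(P : ℝ) - Real.sqrt D| ≤ |(P : ℝ)| + |Real.sqrt D| := abs_sub _ _
      _ ≤ |(P : ℝ)| + D := by rw [abs_of_nonneg (Real.sqrt_nonneg _)]; linarith
  rw [div_le_iff₀ hpos]
  calc (1 : ℝ) ≤ |((P : ℝ) ^ 2 - D)| := hge
    _ = |((P : ℝ) + Real.sqrt D)| * |(P : ℝ) - Real.sqrt D| := hprod.symm
    _ ≤ |((P : ℝ) + Real.sqrt D)| * (|(P : ℝ)| + D) := mul_le_mul_of_nonneg_left hbd (abs_nonneg _)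

/-- The precision used for `P + √D`: `b = a + 3 + size(D + |P|)`. [folklore] -/
def sqrtPrec (D : ℕ) (P : ℤ) (a : ℕ) : ℕ := a + 3 + Nat.size (D + P.natAbs)

/-- **`logQIApprox D P Q a ≈ log |(P + √D)/Q|`**: the logarithm of a rational approximation of
`|P + √D|` (to relative precision `2⁻ᵃ⁻³`) minus the logarithm of `|Q|`. [cite: JacobsonWilliams2008, §11.1–§11.2] -/
def logQIApprox (D : ℕ) (P Q : ℤ) (a : ℕ) : ℚ :=
  logRatApprox |sqrtShiftApprox D P (sqrtPrec D P a)| (a + 2) - logNatApprox Q.natAbs (a + 2)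

/-- **Precision of `logQIApprox`**: `|logQIApprox D P Q a − log |(P + √D)/Q|| ≤ 2⁻ᵃ` for `D ≥ 1`
not a square and `Q ≠ 0`. [cite: JacobsonWilliams2008, §11.1–§11.2] -/
theorem abs_logQIApprox_sub_log_le {D : ℕ} (hD : ¬ IsSquare D) (hD1 : 1 ≤ D) (P : ℤ) {Q : ℤ}
    (hQ : Q ≠ 0) (a : ℕ) :
    |(logQIApprox D P Q a : ℝ) - Real.log (|((P : ℝ) + Real.sqrt D) / Q|)| ≤ (1 / 2) ^ a := by
  set b := sqrtPrec D P a with hb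
  set t : ℚ := sqrtShiftApprox D P b with ht
  set u : ℝ := (P : ℝ) + Real.sqrt D with hu
  have hB : ((D + P.natAbs : ℕ) : ℝ) < 2 ^ Nat.size (D + P.natAbs) := by
    exact_mod_cast Nat.lt_size_self _
  have hBeq : ((D + P.natAbs : ℕ) : ℝ) = |(P : ℝ)| + D := by
    push_cast; rw [Nat.cast_natAbs, Int.cast_abs]; ring
  have hBpos : (0 : ℝ) < |(P : ℝ)| + D := by positivity
  -- lower bound on `|u|` and the approximation error
  have hlow := inv_le_abs_add_sqrt hD hD1 P
  have herr : |(t : ℝ) - u| ≤ 1 / 2 ^ b := abs_sqrtShiftApprox_sub_le D P b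
  have hεb : (1 : ℝ) / 2 ^ b = (1 / 2) ^ (a + 3) / 2 ^ Nat.size (D + P.natAbs) := by
    rw [hb, sqrtPrec, pow_add, one_div_pow]; field_simp
  -- `ε ≤ |u| / (8 · 2^a)`-type bound: `ε · (|P| + D) ≤ (1/2)^(a+3)`
  have hε : (1 : ℝ) / 2 ^ b * (|(P : ℝ)| + D) ≤ (1 / 2) ^ (a + 3) := by
    rw [hεb, ← hBeq, div_mul_eq_mul_div, div_le_iff₀ (by positivity)]
    exact mul_le_mul_of_nonneg_left hB.le (by positivity)
  have hu0 : 0 < |u| := lt_of_lt_of_le (by positivity) hlow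
  -- `ε ≤ |u|/2`
  have hεu : (1 : ℝ) / 2 ^ b ≤ |u| / 2 := by
    have h1 : (1 : ℝ) / 2 ^ b ≤ (1 / 2) ^ (a + 3) / (|(P : ℝ)| + D) := by
      rw [le_div_iff₀ hBpos]; exact hε
    have h2 : (1 / 2 : ℝ) ^ (a + 3) / (|(P : ℝ)| + D) ≤ (1 / 2) * (1 / (|(P : ℝ)| + D)) := by
      rw [div_eq_mul_one_div]
      apply mul_le_mul_of_nonneg_right _ (by positivity)
      calc (1 / 2 : ℝ) ^ (a + 3) ≤ (1 / 2) ^ 1 := pow_le_pow_of_le_one (by norm_num) (by norm_num) (by omega)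
        _ = 1 / 2 := pow_one _
    have h3 : (1 / 2 : ℝ) * (1 / (|(P : ℝ)| + D)) ≤ |u| / 2 := by linarith
    linarith
  have ht0 : |u| / 2 ≤ |(t : ℝ)| := by
    have := abs_sub_abs_le_abs_sub u (t : ℝ)
    rw [abs_sub_comm] at herr
    linarith
  have htpos : 0 < |(t : ℝ)| := lt_of_lt_of_le (by positivity) ht0
  have htQ : 0 < |t| := by
    have : (0 : ℝ) < |((t : ℚ) : ℝ)| := htpos
    rw [← Rat.cast_abs] at this
    exact_mod_cast this
  -- (i) `|log |t| − log |u|| ≤ 2ε/|u| ≤ (1/2)^(a+2)`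
  have h1 : |Real.log (|(t : ℝ)|) - Real.log (|u|)| ≤ (1 / 2) ^ (a + 2) := by
    refine (abs_log_sub_log_le htpos hu0).trans ?_
    have hmin : |u| / 2 ≤ min |(t : ℝ)| |u| := le_min ht0 (by linarith)
    have hnum : |(|(t : ℝ)| - |u|)| ≤ 1 / 2 ^ b := (abs_abs_sub_abs_le_abs_sub _ _).trans herr
    calc |(|(t : ℝ)| - |u|)| / min |(t : ℝ)| |u| ≤ (1 / 2 ^ b) / (|u| / 2) :=
          div_le_div₀ (by positivity) hnum (by positivity) hmin
      _ = 2 * (1 / 2 ^ b) / |u| := by field_simp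
      _ ≤ 2 * (1 / 2 ^ b) / (1 / (|(P : ℝ)| + D)) :=
          div_le_div_of_nonneg_left (by positivity) (by positivity) hlow
      _ = 2 * (1 / 2 ^ b * (|(P : ℝ)| + D)) := by field_simp
      _ ≤ 2 * (1 / 2) ^ (a + 3) := by linarith
      _ = (1 / 2) ^ (a + 2) := by rw [pow_succ (1 / 2 : ℝ) (a + 2)]; ring
  -- (ii) and (iii)
  have h2 : |(logRatApprox |t| (a + 2) : ℝ) - Real.log (|(t : ℝ)|)| ≤ (1 / 2) ^ (a + 2) := by
    have := abs_logRatApprox_sub_log_le htQ (a + 2)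
    rwa [Rat.cast_abs] at this
  have hQ1 : 1 ≤ Q.natAbs := Int.natAbs_pos.mpr hQ
  have h3 : |(logNatApprox Q.natAbs (a + 2) : ℝ) - Real.log (|(Q : ℝ)|)| ≤ (1 / 2) ^ (a + 2) := by
    have := abs_logNatApprox_sub_log_le hQ1 (a + 2)
    rwa [Nat.cast_natAbs, Int.cast_abs] at this
  -- assemble: `log |u/Q| = log |u| − log |Q|`
  have hQR : (Q : ℝ) ≠ 0 := by exact_mod_cast hQ
  have hlog : Real.log |u / Q| = Real.log |u| - Real.log |(Q : ℝ)| := by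
    rw [abs_div, Real.log_div hu0.ne' (abs_ne_zero.mpr hQR)]
  rw [hlog]
  have hsplit : (logQIApprox D P Q a : ℝ) - (Real.log |u| - Real.log |(Q : ℝ)|) =
      ((logRatApprox |t| (a + 2) : ℝ) - Real.log |(t : ℝ)|) + (Real.log |(t : ℝ)| - Real.log |u|) -
        ((logNatApprox Q.natAbs (a + 2) : ℝ) - Real.log |(Q : ℝ)|) := by
    unfold logQIApprox; push_cast; rw [← ht]; ring
  rw [hsplit]
  calc |((logRatApprox |t| (a + 2) : ℝ) - Real.log |(t : ℝ)|) + (Real.log |(t : ℝ)| - Real.log |u|) -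
        ((logNatApprox Q.natAbs (a + 2) : ℝ) - Real.log |(Q : ℝ)|)|
      ≤ |((logRatApprox |t| (a + 2) : ℝ) - Real.log |(t : ℝ)|) + (Real.log |(t : ℝ)| - Real.log |u|)| +
          |(logNatApprox Q.natAbs (a + 2) : ℝ) - Real.log (|(Q : ℝ)|)| := abs_sub _ _
    _ ≤ ((1 / 2) ^ (a + 2) + (1 / 2) ^ (a + 2)) + (1 / 2) ^ (a + 2) :=
        add_le_add ((abs_add_le _ _).trans (add_le_add h2 h1)) h3
    _ ≤ (1 / 2) ^ a := by
        rw [show (1 / 2 : ℝ) ^ (a + 2) = (1 / 2) ^ a / 4 by rw [pow_add]; ring]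
        have : (0 : ℝ) ≤ (1 / 2) ^ a := by positivity
        linarith

/-- A bound on the values: `|logQIApprox| ≤ |log |(P+√D)/Q|| + 1`. [folklore] -/
theorem abs_logQIApprox_le {D : ℕ} (hD : ¬ IsSquare D) (hD1 : 1 ≤ D) (P : ℤ) {Q : ℤ} (hQ : Q ≠ 0) (a : ℕ) :
    |(logQIApprox D P Q a : ℝ)| ≤ |Real.log (|((P : ℝ) + Real.sqrt D) / Q|)| + 1 := by
  have h := abs_logQIApprox_sub_log_le hD hD1 P hQ a
  have h1 : (1 / 2 : ℝ) ^ a ≤ 1 := pow_le_one₀ (by norm_num) (by norm_num)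
  have := abs_sub_abs_le_abs_sub (logQIApprox D P Q a : ℝ) (Real.log |((P : ℝ) + Real.sqrt D) / Q|)
  linarith

/-! ### Dyadic rounding -/

/-- Rounding down to the dyadic grid of mesh `2^{−a}` (keeps all accumulated distances on one grid,
so that their codes stay short). [folklore] -/
def dyRound (a : ℕ) (q : ℚ) : ℚ := (⌊q * 2 ^ a⌋ : ℚ) / 2 ^ a

/-- `|dyRound a q − q| ≤ 2^{−a}`. [folklore] -/
theorem abs_dyRound_sub_le (a : ℕ) (q : ℚ) : |(dyRound a q : ℝ) - q| ≤ (1 / 2) ^ a := by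
  have h1 := Int.floor_le (q * 2 ^ a)
  have h2 := Int.lt_floor_add_one (q * 2 ^ a)
  have hpow : (0 : ℚ) < 2 ^ a := by positivity
  have hq : dyRound a q ≤ q := by
    unfold dyRound; rw [div_le_iff₀ hpow]; exact h1
  have hq' : q - 1 / 2 ^ a < dyRound a q := by
    unfold dyRound; rw [lt_div_iff₀ hpow, sub_mul, div_mul_cancel₀ _ hpow.ne']; linarith
  rw [abs_sub_comm, abs_le, one_div_pow]
  constructor
  · have : (dyRound a q : ℝ) ≤ q := by exact_mod_cast hq
    have h0 : (0 : ℝ) ≤ 1 / 2 ^ a := by positivity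
    linarith
  · have h' : ((q - dyRound a q : ℚ) : ℝ) ≤ ((1 / 2 ^ a : ℚ) : ℝ) := by
      exact_mod_cast (by linarith : q - dyRound a q ≤ 1 / 2 ^ a)
    push_cast at h'
    linarith


end FixedPointLog

end Literature.Computability.Cryptography

end
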